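import Mathlib
import Literature.AlgebraicGeometry.Resolution.BlowupDimension
import Summits.ResolutionOfSingularities.ResolutionOfSingularities.Theorems.HomologicalConductorNoZenoChartFibreClosed
import Summits.ResolutionOfSingularities.ResolutionOfSingularities.Theorems.HomologicalConductorNoZenoThreadStep
import HarnessLib

/-!
# Crux `NoZenoR` (stmt-ResolutionOfSingularities-19943), slot 5 (B1) closer seam 1, (G4):
# a height-two prime of the normalised chart ring is MAXIMAL and lies over the maximal ideal

OURS (cell res-hironaka, crux chain W4.4; §§1–2 = res-D-pv-045 gen 8's farm-clean abstract core
`ChartPrimeMaximal-abstract.lean` c9c698f362c3b77c taken VERBATIM (handover 2026-08-27T20:34:41Z), §3 =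
the `Subalgebra k K` wrappers by res-D-pv-039 gen 14; object (G4) of res-L0-w44-stub-3's FINDING
2026-08-27T20:22Z, placed by res-L0-w44-plan-1 DESK WORD 19 — the side conditions `[𝔮.IsMaximal]` /
«`𝔮 ∩ T` maximal» of (A1) p555760 and (A2) p559940 + p560954, which the slot-5 binders do not carry);
nothing here is a statement of the manuscript under review (Hironaka 2017); AI-written, weaker than
expert review.  SUPPORT-level, counted 0.  Def-free, FACT-FREE: Mathlib + the tree's dimension inequality
`Resolution/BlowupDimension` (+ `nrm`, `locPrime` vocabulary files) only.

THE STATEMENT.  `T` a Noetherian local domain of Krull dimension `2`, `B` a finitely generated `T`-algebra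
which is a domain ALGEBRAIC over `T` (e.g. `B = T[c₁x⁻¹, …, c_n x⁻¹] ⊆ Frac T`, the chart ring), `N` integral
over `B` (e.g. its normalisation `nrm B`), `𝔮 ⊂ N` a prime of height `≥ 2` (e.g. `dim N_𝔮 = 2`).  Then
`𝔮` is MAXIMAL and `𝔮 ∩ T = 𝔪_T` (`isMaximal_and_under_eq_maximalIdeal_of_two_le_height`), and in the
`Subalgebra k K` spelling of the (A2) file: `isMaximal_and_comap_eq_of_le_adjoin` (any `B` with
`T ≤ B ≤ k[T ∪ F]`, `F` finite, `N = nrm B`, `ringKrullDim (locPrime (nrm B) 𝔮) = 2`),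
`isMaximal_and_comap_eq_chart_ideal` (`B = k[T ∪ I·x⁻¹]`, `I` finitely generated — the (A2) spelling)
and `isMaximal_and_comap_eq_chart_set` (`B = k[T ∪ C·x⁻¹]`, `C ⊆ T` any set, `T` Noetherian — the
`Sig.L1Core` spelling), each delivering (L1) `𝔮.IsMaximal` and (L2)
`𝔮.comap (Subalgebra.inclusion hTN).toRingHom = maximalIdeal T` (hence maximal).

THE PROOF (Matsumura Thm. 9.4 + Thm. 15.5, both in the tree).  For every prime `Q` of `N`:
`ht Q ≤ ht (Q ∩ B)` (integrality: contraction of primes is strictly monotone by incomparability,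
`Ideal.IsIntegral.comap_lt_comap`, and `Order.height` is monotone under strictly monotone maps) and
`ht (Q ∩ B) ≤ ht (Q ∩ T)` (the dimension inequality with `tr.deg_T B = 0`, residue term dropped:
`height_le_height_of_liesOver_of_finiteType_of_isAlgebraic`).  So `2 ≤ ht 𝔮 ≤ ht (𝔮 ∩ T) ≤ dim T = 2`
forces `𝔮 ∩ T = 𝔪_T` (`Ideal.height_eq_ringKrullDim_iff`), and a prime `𝔮′ ⊋ 𝔮` would have
`3 ≤ ht 𝔮′ ≤ ht (𝔮′ ∩ T) ≤ 2`.

References: H. Matsumura, *Commutative Ring Theory* (1986), Thm. 9.4, Thm. 15.5 [`Matsumura1987`].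
-/

noncomputable section

-- single-problem summit: the doubled namespace component `ResolutionOfSingularities` is forced
set_option linter.dupNamespace false

namespace Summit.ResolutionOfSingularities.ResolutionOfSingularities.Theorems.NoZeno.ExcCount.ChartFibre

open IsLocalRing Literature.AlgebraicGeometry.Resolution

universe u

/-! ## §1 Heights under an integral extension -/

/-- **`ht Q ≤ ht (Q ∩ B)` for `N ⊇ B` integral** (incomparability: contraction of primes is strictly
monotone, and heights are monotone under strictly monotone maps). [cite: Matsumura1987, Thm. 9.4] -/
theorem height_le_height_under_of_isIntegral {B N : Type*} [CommRing B] [CommRing N] [Algebra B N]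
    [Algebra.IsIntegral B N] (Q : Ideal N) [Q.IsPrime] : Q.height ≤ (Q.under B).height := by
  have hmono : StrictMono (fun q : PrimeSpectrum N => PrimeSpectrum.comap (algebraMap B N) q) :=
    fun p q h => Ideal.IsIntegral.comap_lt_comap (R := B) h
  have h := Order.height_le_height_apply_of_strictMono _ hmono ⟨Q, ‹_›⟩
  rw [← PrimeSpectrum.height_eq_orderHeight, ← PrimeSpectrum.height_eq_orderHeight] at h
  exact h

/-! ## §2 The abstract statement -/

/-- **A height-`≥ 2` prime of an integral extension of a finitely generated algebraic extension of a
two-dimensional Noetherian local domain is maximal and lies over the maximal ideal.**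
[cite: Matsumura1987, Thm. 15.5] -/
theorem isMaximal_and_under_eq_maximalIdeal_of_two_le_height {T B N : Type u} [CommRing T] [CommRing B]
    [CommRing N] [IsNoetherianRing T] [IsLocalRing T] [IsDomain T] [IsDomain B]
    [Algebra T B] [Algebra B N] [Algebra T N] [IsScalarTower T B N] [FaithfulSMul T B]
    [Algebra.FiniteType T B] [Algebra.IsAlgebraic T B] [Algebra.IsIntegral B N]
    (hT : ringKrullDim T = 2) (𝔮 : Ideal N) [𝔮.IsPrime] (h𝔮 : 2 ≤ 𝔮.height) :
    𝔮.IsMaximal ∧ 𝔮.under T = maximalIdeal T := by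
  -- every prime `Q` of `N`: `ht Q ≤ ht (Q ∩ T) ≤ 2`
  have key : ∀ (Q : Ideal N) [Q.IsPrime], Q.height ≤ (Q.under T).height := by
    intro Q _
    have h1 : Q.height ≤ (Q.under B).height := height_le_height_under_of_isIntegral Q
    have h2 : (Q.under B).height ≤ ((Q.under B).under T).height :=
      height_le_height_of_liesOver_of_finiteType_of_isAlgebraic ((Q.under B).under T) (Q.under B)
    rw [Ideal.under_under] at h2
    exact h1.trans h2
  have hle2 : ∀ (p : Ideal T) [p.IsPrime], p.height ≤ 2 := by
    intro p _
    have h := Ideal.height_le_ringKrullDim_of_isPrime (I := p)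
    rw [hT] at h
    exact WithBot.coe_le_coe.mp h
  -- `𝔮 ∩ T = 𝔪_T`
  have hqT : (𝔮.under T).height = 2 := le_antisymm (hle2 _) (h𝔮.trans (key 𝔮))
  haveI : FiniteRingKrullDim T := by
    refine finiteRingKrullDim_iff_ne_bot_and_top.mpr ⟨?_, ?_⟩ <;> rw [hT] <;> decide
  have hunder : 𝔮.under T = maximalIdeal T := by
    refine Ideal.height_eq_ringKrullDim_iff.mp ?_
    rw [hqT, hT]
    rfl
  refine ⟨?_, hunder⟩
  -- `𝔮` is maximal: a larger prime would have height `≥ 3`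
  obtain ⟨M, hM, hqM⟩ := Ideal.exists_le_maximal 𝔮 Ideal.IsPrime.ne_top'
  rcases hqM.lt_or_eq with hlt | heq
  · exfalso
    have h2top : (2 : ℕ∞) < ⊤ := ENat.coe_lt_top 2
    haveI : 𝔮.FiniteHeight := Ideal.finiteHeight_iff_lt.mpr
      (Or.inr (lt_of_le_of_lt ((key 𝔮).trans (hle2 _)) h2top))
    have h1 : 𝔮.height < M.height := Ideal.height_strict_mono_of_isPrime hlt
    have h2 : M.height ≤ 2 := (key M).trans (hle2 _)
    have h3 : (2 : ℕ∞) < M.height := lt_of_le_of_lt h𝔮 h1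
    exact absurd h2 (not_le.mpr h3)
  · rw [heq]
    exact hM


/-! ## §3 The `Subalgebra k K` wrappers (the (A2) / `Sig.L1Core` spellings) -/

section Chart

open Summit.ResolutionOfSingularities.ResolutionOfSingularities.Theorems.NoZeno.Birth
open Summit.ResolutionOfSingularities.ResolutionOfSingularities.Theorems.NoZeno.SandwichCluster
open Parasite (locPrime)

variable {k K : Type} [Field k] [Field K] [Algebra k K]

/-- **(G4), `Subalgebra k K` form.** `T ⊆ K = Frac T` a Noetherian local domain of dimension two,
`B` a `k`-subalgebra with `T ≤ B ≤ k[T ∪ F]` for a finite `F ⊆ B`, `N = nrm B` its normalisation,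
`𝔮 ⊂ N` a prime with `dim N_𝔮 = 2` (`locPrime` spelling). Then `𝔮` is maximal and
`𝔮 ∩ T = 𝔪_T`. [cite: Matsumura1987, Thm. 15.5] -/
theorem isMaximal_and_comap_eq_of_le_adjoin (T : Subalgebra k K) [IsLocalRing ↥T]
    [IsNoetherianRing ↥T] [IsFractionRing ↥T K] (hT : ringKrullDim ↥T = 2)
    {B : Subalgebra k K} (hTB : T ≤ B) (F : Finset K) (hFB : (F : Set K) ⊆ B)
    (hBF : B ≤ Algebra.adjoin k ((T : Set K) ∪ (F : Set K)))
    (hTN : T ≤ nrm B) (𝔮 : Ideal ↥(nrm B)) (h𝔮 : 𝔮.IsPrime)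
    (hdim : ringKrullDim ↥(locPrime (nrm B) 𝔮 h𝔮) = 2) :
    𝔮.IsMaximal ∧ 𝔮.comap (Subalgebra.inclusion hTN).toRingHom = IsLocalRing.maximalIdeal ↥T := by
  classical
  have hBN : B ≤ nrm B := fun y hy =>
    Algebra.subset_adjoin (isIntegral_algebraMap (A := K) (x := (⟨y, hy⟩ : ↥B)))
  letI algTB : Algebra ↥T ↥B := (Subalgebra.inclusion hTB).toRingHom.toAlgebra
  letI algBN : Algebra ↥B ↥(nrm B) := (Subalgebra.inclusion hBN).toRingHom.toAlgebra
  letI algTN : Algebra ↥T ↥(nrm B) := (Subalgebra.inclusion hTN).toRingHom.toAlgebra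
  haveI : IsScalarTower ↥T ↥B ↥(nrm B) := IsScalarTower.of_algebraMap_eq fun _ => Subtype.ext rfl
  haveI : IsScalarTower k ↥T ↥B := IsScalarTower.of_algebraMap_eq fun _ => Subtype.ext rfl
  haveI : FaithfulSMul ↥T ↥B :=
    (faithfulSMul_iff_algebraMap_injective ↥T ↥B).mpr (Subalgebra.inclusion_injective hTB)
  -- `B` is finitely generated over `T` (by `F`)
  haveI : Algebra.FiniteType ↥T ↥B := by
    refine ⟨⟨F.attach.image (fun f : {y // y ∈ F} =>
      (⟨f.1, hFB (Finset.mem_coe.mpr f.2)⟩ : ↥B)), ?_⟩⟩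
    refine eq_top_iff.mpr fun y _ => ?_
    -- the image in `K` of the `T`-subalgebra generated by `F` contains `T ∪ F`, hence `B`
    have hle : B ≤ ((Algebra.adjoin ↥T ((F.attach.image (fun f : {y // y ∈ F} =>
        (⟨f.1, hFB (Finset.mem_coe.mpr f.2)⟩ : ↥B)) : Finset ↥B) : Set ↥B)).restrictScalars k).map
        B.val := by
      refine hBF.trans (Algebra.adjoin_le ?_)
      rintro z (hz | hz)
      · exact ⟨⟨z, hTB hz⟩, Subalgebra.algebraMap_mem _ (⟨z, hz⟩ : ↥T), rfl⟩
      · refine ⟨⟨z, hFB hz⟩, Algebra.subset_adjoin ?_, rfl⟩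
        rw [Finset.coe_image]
        exact ⟨⟨z, Finset.mem_coe.mp hz⟩, Finset.mem_coe.mpr (Finset.mem_attach _ _), rfl⟩
    obtain ⟨w, hw, hwy⟩ := hle y.2
    have hwy' : w = y := Subtype.ext hwy
    rw [← hwy']
    exact hw
  -- `B ⊆ K = Frac T` is algebraic over `T`
  haveI : Algebra.IsAlgebraic ↥T K := IsLocalization.isAlgebraic K (nonZeroDivisors ↥T)
  let ι : ↥B →ₐ[↥T] K := { toRingHom := B.val.toRingHom, commutes' := fun _ => rfl }
  haveI : Algebra.IsAlgebraic ↥T ↥B := Algebra.IsAlgebraic.of_injective ι Subtype.val_injective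
  -- `nrm B` is integral over `B`
  let ιN : ↥(nrm B) →ₐ[↥B] K := { toRingHom := (nrm B).val.toRingHom, commutes' := fun _ => rfl }
  haveI : Algebra.IsIntegral ↥B ↥(nrm B) :=
    ⟨fun y => (isIntegral_algHom_iff ιN Subtype.val_injective).mp (isIntegral_of_mem_nrm B y.2)⟩
  -- `ht 𝔮 = dim N_𝔮 = 2`
  haveI : 𝔮.IsPrime := h𝔮
  letI algNL : Algebra ↥(nrm B) ↥(locPrime (nrm B) 𝔮 h𝔮) :=
    (Subring.inclusion (Thread.toSubring_le_locPrime (nrm B) 𝔮 h𝔮)).toAlgebra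
  haveI := Thread.isLocalization_locPrime (nrm B) 𝔮 h𝔮
  have hh : ringKrullDim ↥(locPrime (nrm B) 𝔮 h𝔮) = 𝔮.height :=
    IsLocalization.AtPrime.ringKrullDim_eq_height 𝔮 _
  have h2 : (2 : ℕ∞) ≤ 𝔮.height := by
    have h' : (2 : WithBot ℕ∞) ≤ (𝔮.height : WithBot ℕ∞) := by rw [← hh, hdim]
    exact WithBot.coe_le_coe.mp h'
  exact isMaximal_and_under_eq_maximalIdeal_of_two_le_height (T := ↥T) (B := ↥B) (N := ↥(nrm B))
    hT 𝔮 h2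

/-- Elements `c·x⁻¹` with `c` in the ideal spanned by a set `G ⊆ T` lie in any `k`-subalgebra
`A ⊇ T` containing the `g·x⁻¹`, `g ∈ G`. [folklore] -/
theorem mul_inv_mem_of_mem_span (T : Subalgebra k K) (G : Set ↥T) (x : K)
    {A : Subalgebra k K} (hTA : T ≤ A) (hGA : ∀ g ∈ G, (g : K) * x⁻¹ ∈ A)
    {c : ↥T} (hc : c ∈ Ideal.span G) : (c : K) * x⁻¹ ∈ A := by
  induction hc using Submodule.span_induction with
  | mem g hg => exact hGA g hg
  | zero => rw [ZeroMemClass.coe_zero, zero_mul]; exact A.zero_mem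
  | add a b _ _ ha hb => rw [AddMemClass.coe_add, add_mul]; exact A.add_mem ha hb
  | smul t a _ ha =>
    rw [smul_eq_mul, MulMemClass.coe_mul, mul_assoc]
    exact A.mul_mem (hTA t.2) ha

/-- **(G4), (A2) spelling**: `B = k[T ∪ I·x⁻¹]` for a finitely generated ideal `I ⊆ T`.
(L1) `𝔮` maximal, (L2) `𝔮 ∩ T = 𝔪_T`. [cite: Matsumura1987, Thm. 15.5] -/
theorem isMaximal_and_comap_eq_chart_ideal (T : Subalgebra k K) [IsLocalRing ↥T]
    [IsNoetherianRing ↥T] [IsFractionRing ↥T K] (hT : ringKrullDim ↥T = 2)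
    {I : Ideal ↥T} (hI : I.FG) (x : ↥T)
    (hTN : T ≤ nrm (Algebra.adjoin k ((T : Set K) ∪
      {y : K | ∃ c : ↥T, c ∈ I ∧ y = (c : K) * (x : K)⁻¹})))
    (𝔮 : Ideal ↥(nrm (Algebra.adjoin k ((T : Set K) ∪
      {y : K | ∃ c : ↥T, c ∈ I ∧ y = (c : K) * (x : K)⁻¹})))) (h𝔮 : 𝔮.IsPrime)
    (hdim : ringKrullDim ↥(locPrime (nrm (Algebra.adjoin k ((T : Set K) ∪
      {y : K | ∃ c : ↥T, c ∈ I ∧ y = (c : K) * (x : K)⁻¹}))) 𝔮 h𝔮) = 2) :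
    𝔮.IsMaximal ∧ 𝔮.comap (Subalgebra.inclusion hTN).toRingHom = IsLocalRing.maximalIdeal ↥T := by
  classical
  obtain ⟨s, hs⟩ := hI
  refine isMaximal_and_comap_eq_of_le_adjoin T hT (fun y hy => Algebra.subset_adjoin (Or.inl hy))
    (s.image fun c : ↥T => (c : K) * (x : K)⁻¹) ?_ ?_ hTN 𝔮 h𝔮 hdim
  · -- `F ⊆ B`
    intro y hy
    rw [Finset.coe_image] at hy
    obtain ⟨c, hc, rfl⟩ := hy
    exact Algebra.subset_adjoin (Or.inr ⟨c, hs ▸ Ideal.subset_span (Finset.mem_coe.mp hc), rfl⟩)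
  · -- `B ≤ k[T ∪ F]`
    refine Algebra.adjoin_le ?_
    rintro y (hy | ⟨c, hc, rfl⟩)
    · exact Algebra.subset_adjoin (Or.inl hy)
    · refine mul_inv_mem_of_mem_span T (s : Set ↥T) (x : K)
        (fun z hz => Algebra.subset_adjoin (Or.inl hz)) (fun g hg => ?_) (hs.symm ▸ hc)
      refine Algebra.subset_adjoin (Or.inr ?_)
      rw [Finset.coe_image]
      exact ⟨g, hg, rfl⟩

/-- **(G4), `Sig.L1Core` spelling**: `B = k[T ∪ C·x⁻¹]` for any set `C ⊆ T` (`T` Noetherian, so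
the ideal spanned by `C` is finitely generated). (L1) `𝔮` maximal, (L2) `𝔮 ∩ T = 𝔪_T`.
[cite: Matsumura1987, Thm. 15.5] -/
theorem isMaximal_and_comap_eq_chart_set (T : Subalgebra k K) [IsLocalRing ↥T]
    [IsNoetherianRing ↥T] [IsFractionRing ↥T K] (hT : ringKrullDim ↥T = 2)
    {C : Set K} (hCT : C ⊆ T) (x : K)
    (hTN : T ≤ nrm (Algebra.adjoin k ((T : Set K) ∪ {y : K | ∃ c ∈ C, y = c * x⁻¹})))
    (𝔮 : Ideal ↥(nrm (Algebra.adjoin k ((T : Set K) ∪ {y : K | ∃ c ∈ C, y = c * x⁻¹}))))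
    (h𝔮 : 𝔮.IsPrime)
    (hdim : ringKrullDim ↥(locPrime (nrm (Algebra.adjoin k ((T : Set K) ∪
      {y : K | ∃ c ∈ C, y = c * x⁻¹}))) 𝔮 h𝔮) = 2) :
    𝔮.IsMaximal ∧ 𝔮.comap (Subalgebra.inclusion hTN).toRingHom = IsLocalRing.maximalIdeal ↥T := by
  classical
  -- the ideal of `T` spanned by (the preimage of) `C` is finitely generated
  obtain ⟨s, hs⟩ : (Ideal.span {d : ↥T | (d : K) ∈ C}).FG := IsNoetherian.noetherian _
  have hTB : T ≤ Algebra.adjoin k ((T : Set K) ∪ {y : K | ∃ c ∈ C, y = c * x⁻¹}) :=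
    fun y hy => Algebra.subset_adjoin (Or.inl hy)
  -- the generators `d ∈ s` lie in the span, so `d·x⁻¹ ∈ B`
  have hsB : ∀ d ∈ s, (d : K) * x⁻¹ ∈
      Algebra.adjoin k ((T : Set K) ∪ {y : K | ∃ c ∈ C, y = c * x⁻¹}) := by
    intro d hd
    have hd' : d ∈ Ideal.span {d : ↥T | (d : K) ∈ C} := hs ▸ Ideal.subset_span hd
    exact mul_inv_mem_of_mem_span T {d : ↥T | (d : K) ∈ C} x hTB
      (fun g hg => Algebra.subset_adjoin (Or.inr ⟨(g : K), hg, rfl⟩)) hd'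
  refine isMaximal_and_comap_eq_of_le_adjoin T hT hTB (s.image fun d : ↥T => (d : K) * x⁻¹)
    ?_ ?_ hTN 𝔮 h𝔮 hdim
  · intro y hy
    rw [Finset.coe_image] at hy
    obtain ⟨d, hd, rfl⟩ := hy
    exact hsB d (Finset.mem_coe.mp hd)
  · refine Algebra.adjoin_le ?_
    rintro y (hy | ⟨c, hc, rfl⟩)
    · exact Algebra.subset_adjoin (Or.inl hy)
    · have hcG : (⟨c, hCT hc⟩ : ↥T) ∈ Ideal.span {d : ↥T | (d : K) ∈ C} :=
        Ideal.subset_span (show ((⟨c, hCT hc⟩ : ↥T) : K) ∈ C from hc)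
      rw [← hs] at hcG
      refine mul_inv_mem_of_mem_span T (s : Set ↥T) x
        (fun z hz => Algebra.subset_adjoin (Or.inl hz)) (fun g hg => ?_) hcG
      refine Algebra.subset_adjoin (Or.inr ?_)
      rw [Finset.coe_image]
      exact ⟨g, hg, rfl⟩

/-- (L2) as consumed by (A2) `closure_subset_preimage_chart_nrm`: the contraction of `𝔮` to `T`
is maximal. [folklore] -/
theorem comap_inclusion_isMaximal_of_eq (T : Subalgebra k K) [IsLocalRing ↥T]
    {N : Subalgebra k K} (hTN : T ≤ N) (𝔮 : Ideal ↥N)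
    (h : 𝔮.comap (Subalgebra.inclusion hTN).toRingHom = IsLocalRing.maximalIdeal ↥T) :
    (𝔮.comap (Subalgebra.inclusion hTN).toRingHom).IsMaximal := by
  rw [h]; exact IsLocalRing.maximalIdeal.isMaximal ↥T

end Chart

end Summit.ResolutionOfSingularities.ResolutionOfSingularities.Theorems.NoZeno.ExcCount.ChartFibre

end
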